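import Summits.AtomisticToContinuum.HydrodynamicLimit.Theorems.JParityClosureLocalSecondLawRegularRangeReduction

/-!
# Coarse bounds at the doubled radius, pre-shock: the density half from `DensityCap` (by name)
(stmt-AtomisticToContinuum-13081, line `exact-entropy-ledger-three-passivities`, continuation lead c5)

`CoarseBounds2r′` — the input of `strain_of_coarseBounds_preShock` / `thermalStrain_of_coarseBounds_preShock`
(`…ReductionsPreShock.lean`): caps `ρ_{2r} ≤ D`, `e_{2r} ≤ E` on `[0,τ] × 𝕋³`, `τ < T`, off an event of probability `≤ δ` on
the regular range, with `D, E` chosen BEFORE `r` — has a density half and an energy half.  The density half is the route crux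
`JParityClosure.DensityCap` (stmt-13082, BY NAME) read at radius `2r`, horizon `t := τ < T` and level `η := 1`, with the
`r`-independent cap `D := C + 2`, `C` a bound of the classical density on the compact `[0,τ] × 𝕋³`
(`IsSmoothSpaceTimeOn.exists_norm_le_of_isCompact`); the energy half ("no hot spot at scale `2r` before the shock", cap `E`
before `r`) is INLINED as the second hypothesis — a DensityCap-class statement for the coarse kinetic energy with no producer on
the board yet (an energy-field analogue of 13082; KineticEnergyTails 13087 + the fixed-time energy LLN pre-shock).

`coarseBoundsPreShock_of_densityCap : DensityCap → EnergyCap′ → CoarseBounds2r′` (conclusion verbatim the reductions' input).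
-/

noncomputable section

open scoped BigOperators Topology ENNReal InnerProductSpace
open Filter Set MeasureTheory

namespace Summit.AtomisticToContinuum.HydrodynamicLimit.Theorems.LocalSecondLawLedger

open Literature.MathematicalPhysics.KineticTheory
open Literature.Analysis.FluidPDE
open Summit.AtomisticToContinuum.HydrodynamicLimit.Theses
open Summit.AtomisticToContinuum.HydrodynamicLimit.Theorems.LocalSecondLawNegative

variable {N : ℕ}

/-- **`CoarseBounds2r′` from `DensityCap` and an energy cap** (`coarseBoundsPreShock_of_densityCap`; see the module
docstring).  Thresholds: `σ₀ := min`; `D := C + 2` with `‖ρ‖ ≤ C` on `[0,τ] × 𝕋³`; `E`, `r_E` from the energy cap at `δ/2`;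
`r_D` from `DensityCap` at `(t, η, δ) := (τ, 1, δ/2)`, used at radius `2r < r_D`; `r₀ := min (r_D/2) r_E`, `N₀ := max`;
`{Regular ∧ ∃ (s,x), D < ρ_{2r} ∨ E < e_{2r}} ⊆ capEvent(2r) ∪ {Regular ∧ ∃ (s,x), E < e_{2r}}`, union bound. -/
theorem coarseBoundsPreShock_of_densityCap :
  JParityClosure.DensityCap → (∀ (a₀ θ₀ : T3 → ℝ) (u₀ : T3 → V3), Continuous a₀ → Continuous θ₀ → Continuous u₀ → (∀ x, 0 < a₀ x) → (∀ x, 0 < θ₀ x) → ∃ σ₀ : ℝ, 0 < σ₀ ∧ ∀ σ : ℝ, 0 < σ → σ < σ₀ → ∀ (T : ℝ) (ρ θ : ℝ → T3 → ℝ) (u : ℝ → T3 → V3), IsHardSphereEulerSolution σ T ρ u θ → ∀ Φ : (N : ℕ) → Flow σ N, TendstoHydroFieldsAt (fun N => localGibbsLaw σ a₀ u₀ θ₀ N (Φ N)) Φ ρ u θ 0 → 0 < T → ∀ τ : ℝ, 0 < τ → τ < T → ∀ c η₁ : ℝ, 0 < c → ∀ δ : ℝ, 0 < δ → ∃ E :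 ℝ, 0 < E ∧ ∃ r₀ : ℝ, 0 < r₀ ∧ ∀ r : ℝ, 0 < r → r < r₀ → ∃ N₀ : ℕ, ∀ N : ℕ, N₀ ≤ N → localGibbsLaw σ a₀ u₀ θ₀ N (Φ N) {z | Regular σ r τ c η₁ (Φ N) z ∧ ∃ s ∈ Set.Icc (0 : ℝ) τ, ∃ x : T3, E < kinC (2 * r) ((Φ N).flow s z) x} ≤ ENNReal.ofReal δ) → ∀ (a₀ θ₀ : T3 → ℝ) (u₀ : T3 → V3), Continuous a₀ → Continuous θ₀ → Continuous u₀ → (∀ x, 0 < a₀ x) → (∀ x, 0 < θ₀ x) → ∃ σ₀ : ℝ, 0 < σ₀ ∧ ∀ σ : ℝ, 0 < σ → σ < σ₀ → ∀ (T : ℝ) (ρ θ : ℝ → T3 → ℝ) (u : ℝ → T3 → V3), IsHardSphereEulerSolution σ T ρ u θ → ∀ Φ : (N : ℕ) → Flow σ N, TendstoHydroFieldsAt (fun N => localGibbsLaw σ a₀ u₀ θ₀ N (Φ N)) Φ ρ u θ 0 → 0 < T → ∀ τ : ℝ, 0 < τ → τ < T → ∀ c η₁ : ℝ, 0 < c →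 ∀ δ : ℝ, 0 < δ → ∃ D : ℝ, 0 < D ∧ ∃ E : ℝ, 0 < E ∧ ∃ r₀ : ℝ, 0 < r₀ ∧ ∀ r : ℝ, 0 < r → r < r₀ → ∃ N₀ : ℕ, ∀ N : ℕ, N₀ ≤ N → localGibbsLaw σ a₀ u₀ θ₀ N (Φ N) {z | Regular σ r τ c η₁ (Φ N) z ∧ ∃ s ∈ Set.Icc (0 : ℝ) τ, ∃ x : T3, D < rhoC (2 * r) ((Φ N).flow s z) x ∨ E < kinC (2 * r) ((Φ N).flow s z) x} ≤ ENNReal.ofReal δ := by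
  intro hDC hEC a₀ θ₀ u₀ ha hθ hu ha0 hθ0
  obtain ⟨σD, hσD, HD⟩ := DensityCapNegative.densityCap_iff.1 hDC a₀ θ₀ u₀ ha hθ hu ha0 hθ0
  obtain ⟨σE, hσE, HE⟩ := hEC a₀ θ₀ u₀ ha hθ hu ha0 hθ0
  refine ⟨min σD σE, lt_min hσD hσE, ?_⟩
  intro σ hσ hσlt T ρ θ u hE Φ h0 hT τ hτ hτT c η₁ hc δ hδ
  have hσD' : σ < σD := lt_of_lt_of_le hσlt (min_le_left _ _)
  have hσE' : σ < σE := lt_of_lt_of_le hσlt (min_le_right _ _)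
  have hδ2 : 0 < δ / 2 := by positivity
  have hτIco : τ ∈ Set.Ico 0 T := ⟨hτ.le, hτT⟩
  -- the `r`-independent density cap `D := C + 2`, `‖ρ‖ ≤ C` on `[0,τ] × 𝕋³`
  obtain ⟨C, hC⟩ := hE.smooth_density.exists_norm_le_of_isCompact isCompact_Icc (Set.Icc_subset_Ico_right hτT)
  have hC0 : 0 ≤ C := (norm_nonneg _).trans (hC 0 ⟨le_rfl, hτ.le⟩ (Classical.arbitrary T3))
  -- the energy cap at `δ/2`
  obtain ⟨E, hE0, rE, hrE, HE'⟩ := HE σ hσ hσE' T ρ θ u hE Φ h0 hT τ hτ hτT c η₁ hc (δ / 2) hδ2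
  -- the density cap at `(τ, 1, δ/2)`
  obtain ⟨rD, hrD, HD'⟩ := HD σ hσ hσD' T ρ θ u hE Φ h0 τ hτIco 1 (δ / 2) one_pos hδ2
  refine ⟨C + 2, by linarith, E, hE0, min (rD / 2) rE, lt_min (by positivity) hrE, ?_⟩
  intro r hr hrlt
  have h2r : 2 * r < rD := by
    have := lt_of_lt_of_le hrlt (min_le_left _ _)
    linarith
  obtain ⟨ND, HND⟩ := HD' (2 * r) (by positivity) h2r
  obtain ⟨NE, HNE⟩ := HE' r hr (lt_of_lt_of_le hrlt (min_le_right _ _))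
  refine ⟨max ND NE, fun N hN => ?_⟩
  have ED := HND N ((le_max_left _ _).trans hN)
  have EE := HNE N ((le_max_right _ _).trans hN)
  have hsub : {z | Regular σ r τ c η₁ (Φ N) z ∧ ∃ s ∈ Set.Icc (0 : ℝ) τ, ∃ x : T3,
        C + 2 < rhoC (2 * r) ((Φ N).flow s z) x ∨ E < kinC (2 * r) ((Φ N).flow s z) x} ⊆
      DensityCapNegative.capEvent Φ N ρ τ 1 (2 * r) ∪
        {z | Regular σ r τ c η₁ (Φ N) z ∧ ∃ s ∈ Set.Icc (0 : ℝ) τ, ∃ x : T3,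
          E < kinC (2 * r) ((Φ N).flow s z) x} := by
    rintro z ⟨hReg, s, hs, x, hx⟩
    rcases hx with hD | hEx
    · left
      simp only [DensityCapNegative.capEvent, Set.mem_setOf_eq]
      refine ⟨s, hs, x, ?_⟩
      -- the crux's mollified density is the ledger's `rhoC` (same cone kernel; definitional)
      change ρ s x + 1 < rhoC (2 * r) ((Φ N).flow s z) x
      have h1 : ρ s x ≤ C := (Real.le_norm_self _).trans (hC s hs x)
      linarith
    · exact Or.inr ⟨hReg, s, hs, x, hEx⟩
  calc localGibbsLaw σ a₀ u₀ θ₀ N (Φ N)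
        {z | Regular σ r τ c η₁ (Φ N) z ∧ ∃ s ∈ Set.Icc (0 : ℝ) τ, ∃ x : T3,
          C + 2 < rhoC (2 * r) ((Φ N).flow s z) x ∨ E < kinC (2 * r) ((Φ N).flow s z) x}
      ≤ localGibbsLaw σ a₀ u₀ θ₀ N (Φ N)
          (DensityCapNegative.capEvent Φ N ρ τ 1 (2 * r) ∪
            {z | Regular σ r τ c η₁ (Φ N) z ∧ ∃ s ∈ Set.Icc (0 : ℝ) τ, ∃ x : T3,
              E < kinC (2 * r) ((Φ N).flow s z) x}) := measure_mono hsub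
    _ ≤ _ := measure_union_le _ _
    _ ≤ ENNReal.ofReal (δ / 2) + ENNReal.ofReal (δ / 2) := add_le_add ED EE
    _ = ENNReal.ofReal δ := by rw [← ENNReal.ofReal_add hδ2.le hδ2.le, add_halves]

end Summit.AtomisticToContinuum.HydrodynamicLimit.Theorems.LocalSecondLawLedger

end
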